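import Mathlib
import Literature.NumberTheory.Transcendental.KZCalculus
import Literature.NumberTheory.Transcendental.SemialgebraicAlgebraicPoints
import Literature.NumberTheory.Transcendental.SemialgebraicMapsProofs
import HarnessLib

/-!
# Stub `stub_parametersAlgebraic` — crux `TorsionLogs.NeronTorsionSector`, line `registered` (block S2)

All algebraicity of the torsion translation chain is FORCED by the mere existence of the crux's
`ℚ`-semialgebraic representation `rI = [e₁ < x′ < x < x_P, x′ dx dx′/(√f(x′)√f(x))]` on the real curve
`y² = f(x) = 4x³ − g₂x − g₃` (`e₁ > 0` its largest root): a `KZ.IntegralRep` has a `ℚ`-semialgebraic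
domain and a `ℚ`-semialgebraic integrand on it, and

* `e₁`, `x_P` are the endpoints of the `ℚ`-semialgebraic projection `{e₁ < t < x_P} ⊆ ℝ¹` of the domain
  (Tarski–Seidenberg, `IsSemialgebraic.image_comp`), i.e. boundary points of a `ℚ`-semialgebraic subset of
  the line, hence algebraic (`isAlgebraic_of_mem_frontier`);
* a `ℚ`-semialgebraic function takes algebraic values at rational points
  (`IsSemialgebraicFunOn.isAlgebraic_apply`), so for rationals `e₁ < x′ < x < x_P` the value
  `x′/(√f(x′)√f(x))`, hence the product `f(x′)f(x)`, is algebraic; three rational abscissae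
  `x₁ < x₂ < x₃` give `f(x₁)² = (f(x₁)f(x₂))(f(x₁)f(x₃))/(f(x₂)f(x₃))` algebraic, so `f(x₁)`, then
  `f(x₂) = (f(x₁)f(x₂))/f(x₁)`, are algebraic, and the two linear equations
  `g₂xᵢ + g₃ = 4xᵢ³ − f(xᵢ)` give `g₂`, `g₃` algebraic.

References: J. Bochnak, M. Coste, M.-F. Roy, *Real Algebraic Geometry* (1998), §2.1–2.2;
M. Kontsevich, D. Zagier, *Periods* (2001), §1.1.
-/

noncomputable section

-- `Summit.KontsevichZagierPeriods.KontsevichZagierPeriods.…` is the tree's mandated layout (single-conjunct summit).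
set_option linter.dupNamespace false

open Set Filter Topology
open Literature.NumberTheory.Transcendental Literature.ModelTheory.ExponentialFields

namespace Summit.KontsevichZagierPeriods.KontsevichZagierPeriods.Cruxes.NeronTorsionSector.Translation

/-- **Endpoints of a `ℚ`-semialgebraic open interval of the line are algebraic.** If `a < b` and
`{t ∈ ℝ¹ | a < t 0 < b}` is `ℚ`-semialgebraic then `a` and `b` are algebraic over `ℚ`: they are the
boundary points of the interval (`frontier_Ioo`, transported along `ℝ¹ ≃ₜ ℝ`), and boundary points of
`ℚ`-semialgebraic subsets of the line are algebraic (`isAlgebraic_of_mem_frontier`).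
[cite: BochnakCosteRoy1998, §2.1] -/
theorem isAlgebraic_endpoints_of_isSemialgebraic_Ioo {a b : ℝ} (hab : a < b)
    (hs : IsSemialgebraic ℚ {t : Fin 1 → ℝ | a < t 0 ∧ t 0 < b}) :
    IsAlgebraic ℚ a ∧ IsAlgebraic ℚ b := by
  set e := Homeomorph.funUnique (Fin 1) ℝ with he
  have hse : {t : Fin 1 → ℝ | a < t 0 ∧ t 0 < b} = e ⁻¹' Ioo a b := by
    ext t
    simp [he, Fin.default_eq_zero]
  have hfr : frontier {t : Fin 1 → ℝ | a < t 0 ∧ t 0 < b} = e ⁻¹' {a, b} := by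
    rw [hse, ← e.preimage_frontier, frontier_Ioo hab]
  constructor
  · exact isAlgebraic_of_mem_frontier (x := fun _ : Fin 1 => a) hs (by rw [hfr]; simp [he])
  · exact isAlgebraic_of_mem_frontier (x := fun _ : Fin 1 => b) hs (by rw [hfr]; simp [he])

/-- **The `x`-projection of the triangle is `ℚ`-semialgebraic.** If the `ℚ`-semialgebraic `D ⊆ ℝ²` is
the triangle `{e₁ < z 1 < z 0 < x_P}`, then its image `{e₁ < t 0 < x_P} ⊆ ℝ¹` under the first-coordinate
projection is `ℚ`-semialgebraic (Tarski–Seidenberg, `IsSemialgebraic.image_comp`).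
[cite: BochnakCosteRoy1998, Prop. 2.2.6 and §2.2] -/
theorem isSemialgebraic_proj_triangle {e₁ xP : ℝ} {D : Set (Fin 2 → ℝ)} (hD : IsSemialgebraic ℚ D)
    (hdom : D = {z | e₁ < z 1 ∧ z 1 < z 0 ∧ z 0 < xP}) :
    IsSemialgebraic ℚ {t : Fin 1 → ℝ | e₁ < t 0 ∧ t 0 < xP} := by
  have himg := hD.image_comp (fun _ : Fin 1 => (0 : Fin 2))
  convert himg using 1
  ext t
  simp only [mem_setOf_eq, mem_image, hdom]
  constructor
  · rintro ⟨h1, h2⟩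
    refine ⟨![t 0, (e₁ + t 0) / 2], ⟨?_, ?_, ?_⟩, ?_⟩
    · simp only [Matrix.cons_val_one, Matrix.cons_val_fin_one]
      linarith
    · simp only [Matrix.cons_val_one, Matrix.cons_val_fin_one, Matrix.cons_val_zero]
      linarith
    · simpa using h2
    · funext i
      simp [Fin.eq_zero i]
  · rintro ⟨z, ⟨h1, h2, h3⟩, rfl⟩
    simp only [Function.comp_apply]
    exact ⟨h1.trans h2, h3⟩

/-- **Products `f(x′)f(x)` at rational points of the triangle are algebraic.** For the crux's
representation `rI` (domain the triangle `{e₁ < z 1 < z 0 < x_P}`, integrand `z 1/(√f(z 1)√f(z 0))` on it,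
`f > 0` beyond `e₁ ≥ 0`) and rationals `e₁ < q < p < x_P`, the value `q/(√f(q)√f(p))` of the
`ℚ`-semialgebraic integrand at the rational point `(p, q)` is algebraic
(`IsSemialgebraicFunOn.isAlgebraic_apply`), hence so is `f(q)f(p) = q²/value²`.
[cite: BochnakCosteRoy1998, Prop. 2.2.6 and §2.2] -/
theorem isAlgebraic_mul_of_integralRep {e₁ xP : ℝ} {f : ℝ → ℝ} (he : 0 ≤ e₁)
    (hpos : ∀ x, e₁ < x → 0 < f x) (rI : KZ.IntegralRep 2)
    (hdom : rI.domain = {z | e₁ < z 1 ∧ z 1 < z 0 ∧ z 0 < xP})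
    (hint : EqOn rI.integrand (fun z => z 1 / (Real.sqrt (f (z 1)) * Real.sqrt (f (z 0)))) rI.domain)
    {p q : ℚ} (h1 : e₁ < q) (h2 : (q : ℝ) < p) (h3 : (p : ℝ) < xP) :
    IsAlgebraic ℚ (f q * f p) := by
  have hmem : (![(p : ℝ), q] : Fin 2 → ℝ) ∈ rI.domain := by
    rw [hdom]
    simp only [mem_setOf_eq, Matrix.cons_val_one, Matrix.cons_val_fin_one,
      Matrix.cons_val_zero]
    exact ⟨h1, h2, h3⟩
  have halg : IsAlgebraic ℚ (rI.integrand ![(p : ℝ), q]) :=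
    rI.isSemialgebraicFunOn_integrand.isAlgebraic_apply hmem
      (Fin.forall_fin_two.2 ⟨by simpa using isAlgebraic_rat ℚ p, by simpa using isAlgebraic_rat ℚ q⟩)
  rw [hint hmem] at halg
  simp only [Matrix.cons_val_one, Matrix.cons_val_fin_one, Matrix.cons_val_zero]
    at halg
  have hfq : 0 < f q := hpos _ h1
  have hfp : 0 < f p := hpos _ (h1.trans h2)
  have hq0 : ((q : ℝ)) ≠ 0 := (he.trans_lt h1).ne'
  set v : ℝ := (q : ℝ) / (Real.sqrt (f q) * Real.sqrt (f p)) with hv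
  have hv2 : v ^ 2 = (q : ℝ) ^ 2 / (f q * f p) := by
    rw [hv, div_pow, mul_pow, Real.sq_sqrt hfq.le, Real.sq_sqrt hfp.le]
  have hv0 : v ≠ 0 :=
    div_ne_zero hq0 (mul_ne_zero (Real.sqrt_pos.2 hfq).ne' (Real.sqrt_pos.2 hfp).ne')
  have hprod : f q * f p = (q : ℝ) ^ 2 * (v ^ 2)⁻¹ := by
    rw [hv2, inv_div, mul_div_assoc', mul_div_cancel_left₀ _ (pow_ne_zero 2 hq0)]
  rw [hprod]
  exact ((isAlgebraic_rat ℚ q).pow 2).mul (halg.pow 2).inv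

/-- **STUB S2 (`stub_parametersAlgebraic`) — all algebraicity is forced by the existence of the
`ℚ`-semialgebraic representations.** If representations of the shapes `rI`, `rP` of the crux exist, then
`g₂, g₃, e₁, x_P` are algebraic: `e₁`, `x_P` are frontier points of the `ℚ`-semialgebraic projection
`(e₁, x_P)` of `rI.domain` (`isAlgebraic_of_mem_frontier`, Tarski–Seidenberg `IsSemialgebraic.image_comp`);
a `ℚ`-semialgebraic function takes algebraic values at rational points
(`IsSemialgebraicFunOn.isAlgebraic_apply`), so for rationals `e₁ < x′ < x < x_P` the product `f(x′)f(x)`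
is algebraic; three rational abscissae give `f(x₁)² = (f(x₁)f(x₂))(f(x₁)f(x₃))/(f(x₂)f(x₃))`, so `f(x₁)`,
`f(x₂)` are algebraic, and the linear system `g₂xᵢ + g₃ = 4xᵢ³ − f(xᵢ)` (`i = 1, 2`) gives `g₂`, `g₃`.
(`rP` is not used.) [cite: BochnakCosteRoy1998, Prop. 2.2.6 and §2.2] -/
theorem stub_parametersAlgebraic :
    ∀ (g₂ g₃ e₁ xP : ℝ) (f : ℝ → ℝ), (∀ x, f x = 4 * x ^ 3 - g₂ * x - g₃) → f e₁ = 0 → 0 < e₁ →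
    (∀ x, e₁ < x → 0 < f x) → e₁ < xP →
    ∀ (rI rP : Literature.NumberTheory.Transcendental.KZ.IntegralRep 2),
    rI.domain = {z | e₁ < z 1 ∧ z 1 < z 0 ∧ z 0 < xP} →
    Set.EqOn rI.integrand (fun z => z 1 / (Real.sqrt (f (z 1)) * Real.sqrt (f (z 0)))) rI.domain →
    rP.domain = {z | e₁ < z 0 ∧ e₁ < z 1} →
    Set.EqOn rP.integrand
      (fun z => (Real.sqrt (f (z 0)))⁻¹ * ((g₂ * z 1 + 2 * g₃) / (2 * (z 1) ^ 2 * Real.sqrt (f (z 1))))) rP.domain →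
    IsAlgebraic ℚ g₂ ∧ IsAlgebraic ℚ g₃ ∧ IsAlgebraic ℚ e₁ ∧ IsAlgebraic ℚ xP := by
  intro g₂ g₃ e₁ xP f hf _ he₁ hpos hxP rI _ hdom hint _ _
  -- (i) `e₁`, `x_P`: endpoints of the `ℚ`-semialgebraic projection of the triangle
  obtain ⟨He₁, HxP⟩ := isAlgebraic_endpoints_of_isSemialgebraic_Ioo hxP
    (isSemialgebraic_proj_triangle rI.isSemialgebraic_domain hdom)
  -- (ii) three rational abscissae `e₁ < x₁ < x₂ < x₃ < x_P`
  obtain ⟨x₁, h01, h1P⟩ := exists_rat_btwn hxP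
  obtain ⟨x₂, h12, h2P⟩ := exists_rat_btwn h1P
  obtain ⟨x₃, h23, h3P⟩ := exists_rat_btwn h2P
  have A12 : IsAlgebraic ℚ (f x₁ * f x₂) :=
    isAlgebraic_mul_of_integralRep he₁.le hpos rI hdom hint h01 h12 h2P
  have A13 : IsAlgebraic ℚ (f x₁ * f x₃) :=
    isAlgebraic_mul_of_integralRep he₁.le hpos rI hdom hint h01 (h12.trans h23) h3P
  have A23 : IsAlgebraic ℚ (f x₂ * f x₃) :=
    isAlgebraic_mul_of_integralRep he₁.le hpos rI hdom hint (h01.trans h12) h23 h3P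
  have hf1 : f x₁ ≠ 0 := (hpos _ h01).ne'
  have hf2 : f x₂ ≠ 0 := (hpos _ (h01.trans h12)).ne'
  have hf3 : f x₃ ≠ 0 := (hpos _ ((h01.trans h12).trans h23)).ne'
  have hsq : f x₁ ^ 2 = f x₁ * f x₂ * (f x₁ * f x₃) * (f x₂ * f x₃)⁻¹ := by
    field_simp
  have B1 : IsAlgebraic ℚ (f x₁) :=
    IsAlgebraic.of_pow two_pos (by rw [hsq]; exact (A12.mul A13).mul A23.inv)
  have B2 : IsAlgebraic ℚ (f x₂) := by
    have h : f x₂ = (f x₁)⁻¹ * (f x₁ * f x₂) := by field_simp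
    rw [h]
    exact B1.inv.mul A12
  -- (iii) the linear system `g₂ xᵢ + g₃ = 4 xᵢ³ − f xᵢ`
  have h4 : IsAlgebraic ℚ (4 : ℝ) := by exact_mod_cast isAlgebraic_rat ℚ (4 : ℚ)
  have Hb1 : IsAlgebraic ℚ (4 * (x₁ : ℝ) ^ 3 - f x₁) := (h4.mul ((isAlgebraic_rat ℚ x₁).pow 3)).sub B1
  have Hb2 : IsAlgebraic ℚ (4 * (x₂ : ℝ) ^ 3 - f x₂) := (h4.mul ((isAlgebraic_rat ℚ x₂).pow 3)).sub B2
  have hx12 : (x₂ : ℝ) - x₁ ≠ 0 := sub_ne_zero.2 (ne_of_gt h12)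
  have hg₂ : g₂ = ((4 * (x₂ : ℝ) ^ 3 - f x₂) - (4 * (x₁ : ℝ) ^ 3 - f x₁)) * ((x₂ : ℝ) - x₁)⁻¹ := by
    rw [hf, hf, eq_mul_inv_iff_mul_eq₀ hx12]
    ring
  have G2 : IsAlgebraic ℚ g₂ := by
    rw [hg₂]
    exact (Hb2.sub Hb1).mul ((isAlgebraic_rat ℚ x₂).sub (isAlgebraic_rat ℚ x₁)).inv
  have hg₃ : g₃ = (4 * (x₁ : ℝ) ^ 3 - f x₁) - g₂ * x₁ := by
    rw [hf]
    ring
  have G3 : IsAlgebraic ℚ g₃ := by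
    rw [hg₃]
    exact Hb1.sub (G2.mul (isAlgebraic_rat ℚ x₁))
  exact ⟨G2, G3, He₁, HxP⟩

end Summit.KontsevichZagierPeriods.KontsevichZagierPeriods.Cruxes.NeronTorsionSector.Translation

end
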